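import Mathlib
import Literature.Computability.Cryptography.HallgrenClassGroupIdealCountLower

/-!
# SoloBlind artefact 29 — the MATCHING LEMMA of THEOREM D3 (window positivity ⇒ height), kernel-checked
(`paper/window-height.md` §6 Step 3′; `paper/DIGEST.md` §6(1); claim C113)

Context (soloist `solo-RiemannHypothesis-blind`, session s30).  THEOREM D3 of the report (window positivity `P(a)`
forces every zero `ρ = β + iγ` with `|γ| ≤ 2πe^{2a}(1 - e^{-ca})` to satisfy `|β - ½| < exp(-e^{2ϑa})`) builds its kill
function `G(z) = sin(π(z - u₁)/s₁) · ∏_{w' ∈ 𝒦} (z - w')/(z - ℓ(w'))` from an INJECTIVE assignment `ℓ : 𝒦 → Λ = u₁ + s₁ℤ`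
of lattice points to the images `w'` of the other zeros, with bounded horizontal displacement `|Re w' - ℓ(w')| ≤ L`
(so that `G` is entire and the size estimates (Γ), (Λ₀) hold).  Its existence is the MATCHING LEMMA of Step 3′, proved in
the report from Hall's marriage theorem by splitting the positions into maximal `2L`-chains.  This file certifies that
combinatorial statement in the exact form used there:

* `soloBlind_hallMatching`: if finitely many real positions `pos i` (`i ∈ K`; repetitions allowed — distinct zeros may
  share an ordinate) obey the Riemann–von Mangoldt-type count `#{i ∈ K : α ≤ pos i ≤ β} ≤ (β - α)/s + D` for all `α ≤ β`,
  and the displacement budget satisfies `D + 1 ≤ 2L/s`, then there is `f : ι → ℤ`, injective on `K`, with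
  `|pos i - (u + f(i)·s)| ≤ L` for every `i ∈ K`.
  (In D3: `pos = Re`, `1/s₁ ≥ (1/2π) log₊(T⁺/2π)`, `D = C₂ log(2T⁺ + 3)`, and `L` is chosen with `2L/s₁ - 1 = D`.)
* `soloBlind_hall_condition`: Hall's condition for the lattice windows, by strong induction on the set of positions
  (the chain decomposition of the report: either the positions split across a gap `> 2L` — the two parts have disjoint
  lattice neighbourhoods, induct — or every lattice point of `[α - L, β + L]` is a neighbour, and there are at least
  `(β - α + 2L)/s - 1 ≥ (β - α)/s + D` of them).

What this certifies and what it does not: the lemma is the only combinatorial input of D3; the analytic estimates (Γ),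
(Λ₀) and Steps 4′–7′ remain prose (`paper/referee-notes.md` item 27).  Mathlib (Hall's theorem is
`Finset.all_card_le_biUnion_card_iff_exists_injective`) plus the landed lattice-count lemma
`Literature.Computability.Cryptography.Hallgren2005.le_card_Icc_ceil_floor` (`#[⌈A⌉, ⌊B⌋] ≥ B - A - 1`); no sorries.
-/

namespace Summit.RiemannHypothesis.RiemannHypothesis.Theorems

/-- Membership in the lattice window: the integer `n` lies in `[⌈(x-L-u)/s⌉, ⌊(x+L-u)/s⌋]` iff the lattice point
`u + n s` is within `L` of `x` (`s > 0`). -/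
theorem soloBlind_mem_latticeWindow_iff {s : ℝ} (hs : 0 < s) (u L x : ℝ) (n : ℤ) :
    n ∈ Finset.Icc ⌈(x - L - u) / s⌉ ⌊(x + L - u) / s⌋ ↔ |x - (u + (n : ℝ) * s)| ≤ L := by
  rw [Finset.mem_Icc, Int.ceil_le, Int.le_floor, div_le_iff₀ hs, le_div_iff₀ hs, abs_le]
  constructor <;> rintro ⟨h1, h2⟩ <;> constructor <;> linarith

/-- HALL'S CONDITION for the lattice windows (the chain argument of `window-height.md` §6 Step 3′).
If `#{i ∈ K : α ≤ pos i ≤ β} ≤ (β - α)/s + D` for all `α ≤ β` and `D + 1 ≤ 2L/s` (`s > 0`, `L ≥ 0`), then every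
`S ⊆ K` has at least `#S` integers `n` with `|pos i - (u + n s)| ≤ L` for some `i ∈ S`.  Proof by strong induction on
`S`: if the positions of `S` split across a gap of length `> 2L`, the two parts have disjoint neighbourhoods and the
induction hypothesis adds up; otherwise every lattice point of `[α - L, β + L]` (`α, β` the extreme positions) is a
neighbour, there are `≥ (β - α + 2L)/s - 1` of them, and `#S ≤ (β - α)/s + D ≤ (β - α + 2L)/s - 1`. -/
theorem soloBlind_hall_condition {ι : Type*} (K : Finset ι) (pos : ι → ℝ) {s : ℝ} (hs : 0 < s)
    (u L D : ℝ) (hL : 0 ≤ L) (hD : D + 1 ≤ 2 * L / s)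
    (hK : ∀ α β : ℝ, α ≤ β →
      ((K.filter (fun i => α ≤ pos i ∧ pos i ≤ β)).card : ℝ) ≤ (β - α) / s + D) :
    ∀ S : Finset ι, S ⊆ K →
      S.card ≤ (S.biUnion (fun i => Finset.Icc ⌈(pos i - L - u) / s⌉ ⌊(pos i + L - u) / s⌋)).card := by
  classical
  intro S
  induction S using Finset.strongInduction with
  | H S ih =>
  intro hS
  rcases S.eq_empty_or_nonempty with hSe | hne
  · simp [hSe]
  by_cases hsep : ∃ c : ℝ, (∃ x ∈ S, pos x ≤ c) ∧ (∃ y ∈ S, c + 2 * L < pos y) ∧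
      ∀ z ∈ S, pos z ≤ c ∨ c + 2 * L < pos z
  · -- Case A: the positions split across the gap `(c, c + 2L]`; induct on the two parts.
    obtain ⟨c, ⟨x, hxS, hxc⟩, ⟨y, hyS, hyc⟩, hsplit⟩ := hsep
    have h1sub : S.filter (fun z => pos z ≤ c) ⊂ S :=
      Finset.filter_ssubset.2 ⟨y, hyS, by simp only [not_le]; linarith⟩
    have h2sub : S.filter (fun z => c + 2 * L < pos z) ⊂ S :=
      Finset.filter_ssubset.2 ⟨x, hxS, by simp only [not_lt]; linarith⟩
    have ih1 := ih _ h1sub (fun z hz => hS (Finset.mem_filter.1 hz).1)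
    have ih2 := ih _ h2sub (fun z hz => hS (Finset.mem_filter.1 hz).1)
    have hunion : S = S.filter (fun z => pos z ≤ c) ∪ S.filter (fun z => c + 2 * L < pos z) := by
      ext z
      simp only [Finset.mem_union, Finset.mem_filter]
      constructor
      · intro hz
        rcases hsplit z hz with h | h
        · exact Or.inl ⟨hz, h⟩
        · exact Or.inr ⟨hz, h⟩
      · rintro (⟨hz, _⟩ | ⟨hz, _⟩) <;> exact hz
    have hdisjS : Disjoint (S.filter (fun z => pos z ≤ c)) (S.filter (fun z => c + 2 * L < pos z)) := by
      rw [Finset.disjoint_left]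
      intro z hz1 hz2
      rw [Finset.mem_filter] at hz1 hz2
      linarith [hz1.2, hz2.2]
    have hdisjT : Disjoint
        ((S.filter (fun z => pos z ≤ c)).biUnion
          (fun i => Finset.Icc ⌈(pos i - L - u) / s⌉ ⌊(pos i + L - u) / s⌋))
        ((S.filter (fun z => c + 2 * L < pos z)).biUnion
          (fun i => Finset.Icc ⌈(pos i - L - u) / s⌉ ⌊(pos i + L - u) / s⌋)) := by
      rw [Finset.disjoint_left]
      intro n hn1 hn2
      rw [Finset.mem_biUnion] at hn1 hn2
      obtain ⟨z₁, hz₁, hn₁⟩ := hn1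
      obtain ⟨z₂, hz₂, hn₂⟩ := hn2
      rw [Finset.mem_filter] at hz₁ hz₂
      have e₁ := (soloBlind_mem_latticeWindow_iff hs u L (pos z₁) n).1 hn₁
      have e₂ := (soloBlind_mem_latticeWindow_iff hs u L (pos z₂) n).1 hn₂
      rw [abs_le] at e₁ e₂
      linarith [hz₁.2, hz₂.2, e₁.1, e₁.2, e₂.1, e₂.2]
    have hsubT :
        (S.filter (fun z => pos z ≤ c)).biUnion
            (fun i => Finset.Icc ⌈(pos i - L - u) / s⌉ ⌊(pos i + L - u) / s⌋) ∪
          (S.filter (fun z => c + 2 * L < pos z)).biUnion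
            (fun i => Finset.Icc ⌈(pos i - L - u) / s⌉ ⌊(pos i + L - u) / s⌋) ⊆
        S.biUnion (fun i => Finset.Icc ⌈(pos i - L - u) / s⌉ ⌊(pos i + L - u) / s⌋) :=
      Finset.union_subset
        (Finset.biUnion_subset_biUnion_of_subset_left _ (Finset.filter_subset _ _))
        (Finset.biUnion_subset_biUnion_of_subset_left _ (Finset.filter_subset _ _))
    calc S.card
        = (S.filter (fun z => pos z ≤ c) ∪ S.filter (fun z => c + 2 * L < pos z)).card := by
          rw [← hunion]
      _ = (S.filter (fun z => pos z ≤ c)).card + (S.filter (fun z => c + 2 * L < pos z)).card :=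
          Finset.card_union_of_disjoint hdisjS
      _ ≤ _ := Nat.add_le_add ih1 ih2
      _ = _ := (Finset.card_union_of_disjoint hdisjT).symm
      _ ≤ _ := Finset.card_le_card hsubT
  · -- Case B: no gap; every lattice point of `[α - L, β + L]` is a neighbour of `S`.
    push Not at hsep
    obtain ⟨a, haS, hamin⟩ := Finset.exists_min_image S pos hne
    obtain ⟨b, hbS, hbmax⟩ := Finset.exists_max_image S pos hne
    have hab : pos a ≤ pos b := hamin b hbS
    have hcover : Finset.Icc ⌈(pos a - L - u) / s⌉ ⌊(pos b + L - u) / s⌋ ⊆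
        S.biUnion (fun i => Finset.Icc ⌈(pos i - L - u) / s⌉ ⌊(pos i + L - u) / s⌋) := by
      intro n hn
      rw [Finset.mem_Icc, Int.ceil_le, Int.le_floor, div_le_iff₀ hs, le_div_iff₀ hs] at hn
      by_contra hnot
      have hfar : ∀ z ∈ S, pos z < u + n * s - L ∨ u + n * s + L < pos z := by
        intro z hz
        by_contra hz'
        push Not at hz'
        apply hnot
        simp only [Finset.mem_biUnion]
        refine ⟨z, hz, ?_⟩
        rw [soloBlind_mem_latticeWindow_iff hs, abs_le]
        constructor <;> linarith [hz'.1, hz'.2]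
      obtain ⟨z, hz, hzc⟩ := hsep (u + n * s - L)
        ⟨a, haS, by rcases hfar a haS with h | h <;> linarith [hn.1]⟩
        ⟨b, hbS, by rcases hfar b hbS with h | h <;> linarith [hn.2]⟩
      rcases hfar z hz with h | h
      · linarith [hzc.1]
      · linarith [hzc.2]
    have hSsub : S ⊆ K.filter (fun i => pos a ≤ pos i ∧ pos i ≤ pos b) := by
      intro z hz
      rw [Finset.mem_filter]
      exact ⟨hS hz, hamin z hz, hbmax z hz⟩
    have h1 : (S.card : ℝ) ≤ (pos b - pos a) / s + D :=
      le_trans (by exact_mod_cast Finset.card_le_card hSsub) (hK _ _ hab)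
    have h2 := Literature.Computability.Cryptography.Hallgren2005.le_card_Icc_ceil_floor
      ((pos a - L - u) / s) ((pos b + L - u) / s)
    have h3 : ((Finset.Icc ⌈(pos a - L - u) / s⌉ ⌊(pos b + L - u) / s⌋).card : ℝ) ≤
        ((S.biUnion (fun i => Finset.Icc ⌈(pos i - L - u) / s⌉ ⌊(pos i + L - u) / s⌋)).card : ℝ) := by
      exact_mod_cast Finset.card_le_card hcover
    have hs0 : s ≠ 0 := hs.ne'
    have h4 : (pos b + L - u) / s - (pos a - L - u) / s = (pos b - pos a) / s + 2 * L / s := by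
      field_simp
      ring
    have h5 : (S.card : ℝ) ≤
        ((S.biUnion (fun i => Finset.Icc ⌈(pos i - L - u) / s⌉ ⌊(pos i + L - u) / s⌋)).card : ℝ) := by
      linarith
    exact_mod_cast h5

/-- THE MATCHING LEMMA (`window-height.md` §6 Step 3′, used in THEOREM D3).  Let `K` be a finite set of indices with
real positions `pos i` (repetitions allowed), `s > 0` a lattice spacing, `u` an offset, and suppose the counting bound
`#{i ∈ K : α ≤ pos i ≤ β} ≤ (β - α)/s + D` holds for all real `α ≤ β`.  If `D + 1 ≤ 2L/s`, then there is an
assignment `f : ι → ℤ`, injective on `K`, of lattice points `u + f(i)·s` to the indices with displacement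
`|pos i - (u + f(i)·s)| ≤ L` for every `i ∈ K`.  (Hall's marriage theorem applied to `soloBlind_hall_condition`;
`L ≥ 0` follows from the hypotheses.) -/
theorem soloBlind_hallMatching {ι : Type*} (K : Finset ι) (pos : ι → ℝ) {s : ℝ} (hs : 0 < s)
    (u L D : ℝ) (hD : D + 1 ≤ 2 * L / s)
    (hK : ∀ α β : ℝ, α ≤ β →
      ((K.filter (fun i => α ≤ pos i ∧ pos i ≤ β)).card : ℝ) ≤ (β - α) / s + D) :
    ∃ f : ι → ℤ, Set.InjOn f K ∧ ∀ i ∈ K, |pos i - (u + (f i : ℝ) * s)| ≤ L := by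
  classical
  -- `D ≥ 0` (take `α = β`), hence `2L/s ≥ 1` and `L ≥ 0`.
  have hD0 : 0 ≤ D := by
    have h := hK 0 0 le_rfl
    have h' : (0 : ℝ) ≤ ((K.filter (fun i => (0 : ℝ) ≤ pos i ∧ pos i ≤ 0)).card : ℝ) := Nat.cast_nonneg _
    simp only [sub_self, zero_div, zero_add] at h
    linarith
  have hL : 0 ≤ L := by
    have h1 : (1 : ℝ) ≤ 2 * L / s := by linarith
    rw [le_div_iff₀ hs] at h1
    linarith
  -- Hall's theorem for the family of lattice windows indexed by `K`.
  have hcond : ∀ S : Finset K, S.card ≤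
      (S.biUnion (fun x : K => Finset.Icc ⌈(pos x.1 - L - u) / s⌉ ⌊(pos x.1 + L - u) / s⌋)).card := by
    intro S
    have hsub : S.map (Function.Embedding.subtype (· ∈ K)) ⊆ K := by
      intro z hz
      rw [Finset.mem_map] at hz
      obtain ⟨x, _, rfl⟩ := hz
      exact x.2
    have h := soloBlind_hall_condition K pos hs u L D hL hD hK _ hsub
    rw [Finset.card_map, Finset.map_eq_image, Finset.image_biUnion] at h
    simpa using h
  obtain ⟨g, hg_inj, hg_mem⟩ :=
    (Finset.all_card_le_biUnion_card_iff_exists_injective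
      (fun x : K => Finset.Icc ⌈(pos x.1 - L - u) / s⌉ ⌊(pos x.1 + L - u) / s⌋)).1 hcond
  refine ⟨fun i => if h : i ∈ K then g ⟨i, h⟩ else 0, ?_, ?_⟩
  · intro x hx y hy hxy
    have hx' : x ∈ K := hx
    have hy' : y ∈ K := hy
    simp only [dif_pos hx', dif_pos hy'] at hxy
    have := hg_inj hxy
    simpa using congrArg Subtype.val this
  · intro i hi
    simp only [dif_pos hi]
    exact (soloBlind_mem_latticeWindow_iff hs u L (pos i) _).1 (hg_mem ⟨i, hi⟩)

end Summit.RiemannHypothesis.RiemannHypothesis.Theorems
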